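import Summits.BirchSwinnertonDyer.BirchSwinnertonDyer.Theorems.KatoDescentPotSupersingularReducibleZetaDivisibility
import Literature.NumberTheory.EllipticCurves.Kato2004.EulerSystemIsogenyTransportZeta
import Literature.NumberTheory.EllipticCurves.Kato2004.ValueGuardSatisfiableProofs
import HarnessLib

/-!
# Kato's Λ-adic divisibility on the REDUCIBLE non-CM rank-0 rows, MEMBER-FREE: from the held Euler-system
# fact Z0 (`exists_member_eulerSystem_expStar_values`) there IS a non-zero genuine Euler-system class `𝐲` in
# `𝐇¹_Γ(T_pW)` with `char_Λ X₀(W/ℚ_∞) ∣ char_Λ(𝐇¹_Γ/Λ𝐲)` — modulo {Z0, Kato 13.4, Serre III.7.9(a), FW, Lim 3.5}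

Seat `bsd-potss-rkm` g15 (prover; cell `bsd-potss`), item stmt-BirchSwinnertonDyer-19196 `ReducibleKatoMember` = crux M of K9
`KatoDescentPotSupersingular` / K8-t′ `KatoDescentTamePotSupersingular` (`--supports … --as helper`; closes nothing).  HONEST
FRAMING (cell): BSD is not proved by any of this; nothing is booked; crux M stays cite-level; this is the Iwasawa-level
statement at the curve `W` itself (any member of its class), NOT the level-0 count.

WHAT.  `exists_zetaLift_charIdeal_le_fineSelmerDual` — for `W/ℚ` elliptic without CM, `p ≠ 2` with `E[p]`
REDUCIBLE, `W(ℚ)` and `Ш(W)[p^∞]` finite, `L(W,1) ≠ 0`, a newform `f` of `W` (`IsNewformOf W f`, the tree's spelling of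
modularity for `W`), an embedding family `ι`, the cyclotomic `(κ, γ)`, the pinned `I : IwasawaH1Data W p κ γ` and ANY dual
fine Selmer datum `Y`: **there is `𝐲 ∈ 𝐇¹_Γ(T_pW)`, `𝐲 ≠ 0`, a GENUINE Λ-adic Euler-system class, with
`char_Λ(𝐇¹_Γ(T_pW)/Λ𝐲) ⊆ char_Λ X₀(W/ℚ_∞)`** — the named facts displayed as hypotheses: Z0 (Kato's Euler system
with values at the member; member-free by `forall_exists_zetaBody_of_member`, rkm g14), Kato Thm. 13.4, Serre's
`p`-adic open image (AEC III.7.9 (a)), Ferrero–Washington, Lim 2017 Thm. 3.5.  The admissible datum is Kato's own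
choice (`Kato2004.valueGuard_satisfiable`: `(c, 6pA) = (d, 6pN) = 1`, `(cd, A) = 1`, `dd′ ≡ 1 (A)`, non-zero cusp
factor), `𝐲` its Λ-adic lift (`existsUnique_lift_of_zetaBody`); then `ReducibleZetaDivisibility.charIdeal_quotient_zetaLift_le_charIdeal_fineSelmerDual`.
On these rows this is the divisibility «`char X₀ ∣` (Kato's zeta ideal)» that Kato's Thm. 12.5 (4) gives only under
(12.5.2) and Wuthrich 2014 obtains at reducible `p` via Lemma 14 — here a kernel theorem modulo general facts.
References: [Kato2004Asterisque] Thm. 12.5 (3)–(4), Thm. 12.6 (p. 222), Ex. 13.3 (p. 225), Thm. 13.4 (p. 226);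
[Wuthrich2014] Lemma 14 (p. 396); [SilvermanAEC2009] Thm. III.7.9 (a); [Lim2017FineSelmer] §3 Thm. 3.5.
-/

-- the summit and its single problem are both named `BirchSwinnertonDyer` (registry layout D-0017)
set_option linter.dupNamespace false
set_option autoImplicit false

noncomputable section

open scoped NumberField TensorProduct
open Field IsDedekindDomain WeierstrassCurve CongruenceSubgroup
open Literature.NumberTheory.GaloisRepresentations Literature.NumberTheory.EllipticCurves
open Literature.NumberTheory.EllipticCurves.ModularForms
open Literature.NumberTheory.EllipticCurves.Kato2004 Literature.NumberTheory.EllipticCurves.Kato2004.EulerSystemValues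

namespace Summit.BirchSwinnertonDyer.BirchSwinnertonDyer.Theorems.ReducibleZetaDivisibility

/-- Kato's admissibility `(c, 6pA) = 1`, `(d, 6pN) = 1` with `A, N ≥ 1` forces `2cdAN ≠ 0` (so the bad set of the
Euler system is finite). [cite: Kato2004Asterisque, Ex. 13.3 (p. 225)] -/
theorem two_mul_natAbs_ne_zero_of_gcd {p : ℕ} [hp : Fact p.Prime] {c d : ℤ} {A N : ℕ} (hA : 0 < A) [NeZero N]
    (hc : Int.gcd c (6 * p * A) = 1) (hd : Int.gcd d (6 * p * N) = 1) :
    2 * c.natAbs * d.natAbs * A * N ≠ 0 := by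
  have hp2 : 2 ≤ p := hp.out.two_le
  have hN : 0 < N := Nat.pos_of_ne_zero (NeZero.ne N)
  have hc0 : c ≠ 0 := by
    rintro rfl
    rw [Int.gcd_zero_left] at hc
    have : ((6 * p * A : ℕ) : ℤ).natAbs = 6 * p * A := Int.natAbs_natCast _
    push_cast at this
    rw [this] at hc
    nlinarith
  have hd0 : d ≠ 0 := by
    rintro rfl
    rw [Int.gcd_zero_left] at hd
    have : ((6 * p * N : ℕ) : ℤ).natAbs = 6 * p * N := Int.natAbs_natCast _
    push_cast at this
    rw [this] at hd
    nlinarith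
  have h1 : c.natAbs ≠ 0 := Int.natAbs_ne_zero.mpr hc0
  have h2 : d.natAbs ≠ 0 := Int.natAbs_ne_zero.mpr hd0
  positivity

/-- **Kato's divisibility `char X₀ ∣ char(𝐇¹_Γ/Λ𝐲)` on the reducible non-CM rank-0 rows, member-free.**  For `W/ℚ`
elliptic, non-CM, `p ≠ 2`, `E[p]` reducible, `W(ℚ)` and `Ш(W)[p^∞]` finite, `L(W,1) ≠ 0`, `f` a newform of `W`, the
cyclotomic `(κ, γ)`, pinned `I`, any `Y`: there is a non-zero genuine Λ-adic Euler-system class `𝐲 ∈ 𝐇¹_Γ(T_pW)`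
(the lift of Kato's `(c,d,a(A))`-zeta family for an admissible datum) with
`char_Λ(𝐇¹_Γ(T_pW)/Λ𝐲) ⊆ char_Λ X₀(W/ℚ_∞)` — modulo the displayed named facts {Z0, Kato 13.4, Serre, FW, Lim 3.5}.
[cite: Kato2004Asterisque, Thm. 12.5 (3)–(4) and Thm. 12.6 (p. 222), Thm. 13.4 (2) (p. 226)] [cite: Wuthrich2014, Lemma 14 (p. 396)]
[cite: SilvermanAEC2009, Thm. III.7.9 (a)] [cite: Lim2017FineSelmer, §3 Thm. 3.5] -/
theorem exists_zetaLift_charIdeal_le_fineSelmerDual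
    (hZ0 : exists_member_eulerSystem_expStar_values)
    (h134 : thm13_4_lengthAt_fineSelmerDual_le_of_isEulerSystemClass)
    (hSerre : serre_adicImage_contains_congruenceSubgroup)
    (hLim : Lim2017.thm35_fineSelmerDual_moduleFinite_of_classicalMuVanishes_of_le_divisionField)
    (hFW : Literature.NumberTheory.IwasawaTheory.ferreroWashington1979_classicalMuVanishes)
    (W : WeierstrassCurve ℚ) [W.IsElliptic] (p : ℕ) [Fact p.Prime]
    [ContinuousSMul ℤ_[p] (W.tateModule p)] [Module.Free ℤ_[p] (W.tateModule p)]
    [Module.Finite ℤ_[p] (W.tateModule p)]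
    [Finite W.toAffine.Point] [Finite (AddCommGroup.primaryComponent W.sha p)]
    {κ : ZpExtension ℚ p} {γ : absoluteGaloisGroup ℚ} (hp : p ≠ 2) (hκ : κ.IsCyclotomic)
    (hγ : κ.IsTopGenerator γ) (hCM : ¬ W.HasCM) (hred : ¬ W.HasIrreducibleModPGaloisRep p)
    (I : IwasawaH1Data W p κ γ) (Y : W.FineSelmerDualData κ γ)
    {N : ℕ} [NeZero N] (f : CuspForm (Gamma0 N) 2) (hf : IsNewformOf W f) (hL1 : W.entireLFunction 1 ≠ 0)
    (ι : (m : ℕ) → (CyclotomicField m ℚ →+* ℂ)) :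
    ∃ y : I.H, y ≠ 0 ∧ IsEulerSystemClass W p κ γ I y ∧
      Module.charIdeal (IwasawaAlgebra p) (I.H ⧸ Submodule.span (IwasawaAlgebra p) {y}) ≤
        Module.charIdeal (IwasawaAlgebra p) Y.X := by
  -- Kato's Euler system with values on `T_pW` (member-free) and an admissible datum with non-zero cusp factor
  obtain ⟨κ', hκ', Λ', hΛ'⟩ := forall_exists_zetaBody_of_member hZ0 W p f hf ι
  obtain ⟨c, d, a, A, d', hA, hc, hd, hcd, hdd', hR⟩ := valueGuard_satisfiable f hf.1 hf.coeffField_eq_bot p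
  obtain ⟨z, x, hbody⟩ := hΛ' c d a A hA hc hd
  have hne : 2 * c.natAbs * d.natAbs * A * N ≠ 0 := two_mul_natAbs_ne_zero_of_gcd (p := p) hA hc hd
  -- the Λ-adic lift
  obtain ⟨y, hy, -⟩ := IwasawaH1Data.existsUnique_lift_of_zetaBody p W hκ hp I f ι κ' Λ' c d a A z x hbody
  have hnt : ¬ IsOfFinAddOrder (I.proj 0 y) :=
    MemberIndexOfValue.not_isOfFinAddOrder_proj_zero_of_zetaBody hκ hp hbody hκ' hf hL1 hA d' hcd hdd' hR hy
  have hy0 : y ≠ 0 := by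
    rintro rfl
    exact hnt (by rw [map_zero]; exact isOfFinAddOrder_iff_nsmul_eq_zero.mpr ⟨1, one_pos, by simp⟩)
  exact ⟨y, hy0, isEulerSystemClass_of_zetaBody W p hκ hp I hbody hne hy,
    charIdeal_quotient_zetaLift_le_charIdeal_fineSelmerDual h134 hSerre hLim hFW W p hp hκ hγ hCM hred I Y
      hbody hne hy hf hL1 hκ' hA d' hcd hdd' hR⟩

end Summit.BirchSwinnertonDyer.BirchSwinnertonDyer.Theorems.ReducibleZetaDivisibility

end
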